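import Mathlib
import Summits.MatrixMultiplication.MatrixMultiplication.Theses.LevelGradedCohnUmans
import Literature.Combinatorics.Additive.TripleProductProperty

/-!
# Crux idea `middle-neumann` — first lemmas (crux-ideate round 1, ideator k = 3)

Crux: `LevelGradedCohnUmans.LevelTwoBeatsCubes` (item stmt-MatrixMultiplication-7612).
Lever: the MIDDLE Neumann ordering `|Y|·(|X|+|Z|−1) ≤ rank(ev_P) ≤ dim J₂` for 2-token-separated
triples, on the SAME product set `P = X⁻¹ Y Y⁻¹ Z` (conjectural: graded separation is not cyclically
symmetric, so the rotation argument that proves the middle ordering for plain TPP does not apply),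
and its plain-TPP shadow `|X⁻¹YY⁻¹Z| ≥ |Y|·(|X|+|Z|−1)` (also apparently unrecorded: Neumann's
inequality for the rotated triple bounds `|Y⁻¹ZZ⁻¹X|`, a different set).
Nothing here is proved; the statements only have to elaborate.
-/

namespace Summit.MatrixMultiplication.MatrixMultiplication.Cruxes.LevelTwoBeatsCubes.MiddleNeumann

open scoped BigOperators
open Finset

/-- The crux's first conjunct, verbatim: `(X, Y, Z)` is 2-token separated in `𝔖ₙ`. -/
def TwoTokenSeparated {n : ℕ} (X Y Z : Finset (Equiv.Perm (Fin n))) : Prop :=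
  ∀ x₀ ∈ X, ∀ z₀ ∈ Z, ∃ c : (Fin 2 → Fin n) → (Fin 2 → Fin n) → ℂ, ∀ x ∈ X, ∀ y ∈ Y, ∀ y' ∈ Y, ∀ z ∈ Z,
    (∑ p : Fin 2 → Fin n, c p (⇑(x⁻¹ * y * y'⁻¹ * z) ∘ p)) = if x = x₀ ∧ y = y' ∧ z = z₀ then 1 else 0

/-- `J₂`: the span of the 2-token (2-coset) indicator functions on `𝔖ₙ`
(same rendering as in the sibling card `graded-neumann-rank`). -/
noncomputable def twoTokenSpace (n : ℕ) : Submodule ℂ (Equiv.Perm (Fin n) → ℂ) :=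
  Submodule.span ℂ {f | ∃ p q : Fin 2 → Fin n,
    f = fun g : Equiv.Perm (Fin n) => if (⇑g ∘ p) = q then (1 : ℂ) else 0}

/-- Evaluation at `g`, as a linear functional on `J₂`. -/
noncomputable def evalAt (n : ℕ) (g : Equiv.Perm (Fin n)) : twoTokenSpace n →ₗ[ℂ] ℂ :=
  (LinearMap.proj g).comp (twoTokenSpace n).subtype

/-- The product set `P = X⁻¹ Y Y⁻¹ Z = {x⁻¹ y y'⁻¹ z}` of a triple in any group. -/
def productSet {G : Type*} [Group G] [DecidableEq G] (X Y Z : Finset G) : Finset G :=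
  (((X ×ˢ Y) ×ˢ Y) ×ˢ Z).image fun q => q.1.1.1⁻¹ * q.1.1.2 * q.1.2⁻¹ * q.2

/-- The rank of the evaluation functionals `{ev_g : g ∈ P}` on `J₂`. -/
noncomputable def evalRank {n : ℕ} (X Y Z : Finset (Equiv.Perm (Fin n))) : ℕ :=
  Module.finrank ℂ (Submodule.span ℂ ((evalAt n) '' (productSet X Y Z : Set (Equiv.Perm (Fin n)))))

/-- FIRST LEMMA (graded middle ordering, strong form; CONJECTURAL — supported by exhaustive
`n = 4` and sampled `n = 5` data, kit j008605 at `n = 6`): a 2-token-separated triple carries at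
least `|Y|·(|X|+|Z|−1)` linearly independent evaluation functionals at points of `P`. -/
theorem stub_middleNeumann_rank {n : ℕ} {X Y Z : Finset (Equiv.Perm (Fin n))}
    (hsep : TwoTokenSeparated X Y Z) (hX : X.Nonempty) (hZ : Z.Nonempty) :
    Y.card * (X.card + Z.card - 1) ≤ evalRank X Y Z := by
  sorry

/-- The form the refutation uses: `|Y|·(|X|+|Z|−1) ≤ dim J₂` (from the strong form and
`evalRank ≤ finrank (Dual J₂) = finrank J₂`). -/
theorem stub_middleNeumann {n : ℕ} {X Y Z : Finset (Equiv.Perm (Fin n))}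
    (hsep : TwoTokenSeparated X Y Z) (hX : X.Nonempty) (hZ : Z.Nonempty) :
    Y.card * (X.card + Z.card - 1) ≤ Module.finrank ℂ (twoTokenSpace n) := by
  sorry

/-- Plain-TPP shadow (CONJECTURAL; supported by ~10⁴ TPP triples each in `𝔖₅`, `𝔖₆`, kit j008830
over SmallGroups of order ≤ 40): the middle Neumann count holds on the UN-rotated product set. -/
theorem stub_tppMiddleLaw {G : Type*} [Group G] [DecidableEq G] (X Y Z : Finset G)
    (htpp : Literature.Combinatorics.Additive.TripleProductProperty X Y Z)
    (hX : X.Nonempty) (hZ : Z.Nonempty) :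
    Y.card * (X.card + Z.card - 1) ≤ (productSet X Y Z).card := by
  sorry

/-- Arithmetic endgame with all three orderings (TRUE, elementary: summing the three constraints
gives `2(ab+bc+ca) ≤ 3D + a + b + c`, then AM–GM `abc ≤ ((ab+bc+ca)/3)^{3/2}`). -/
theorem stub_threeOrderings_volume (a b c D : ℕ)
    (h₁ : a * (b + c - 1) ≤ D) (h₂ : c * (a + b - 1) ≤ D) (h₃ : b * (a + c - 1) ≤ D) :
    ((a * b * c : ℕ) : ℝ) ≤ (((3 * D + a + b + c : ℕ) : ℝ) / 6) ^ ((3 : ℝ) / 2) := by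
  sorry

/-- Sanity: the crux decl this card answers to (type-checks the import). -/
example : Prop := Summit.MatrixMultiplication.MatrixMultiplication.Theses.LevelGradedCohnUmans.LevelTwoBeatsCubes

end Summit.MatrixMultiplication.MatrixMultiplication.Cruxes.LevelTwoBeatsCubes.MiddleNeumann
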